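import Literature.Topology.FourManifolds.LatticeFormsPolarisationStabiliserQuotient
import HarnessLib

/-!
# `|O(L_{2t}, h_d)/Õ(L_{2t}, h_d)|` in closed form for EVERY divisor `f = div(h_d)`:
# `#{x mod 2t : x² ≡ 1 (mod 4t), x ≡ 1 (mod f)} = 2^{#{p ∣ t/f : p ∤ f}}` (`f` odd), `= 2^{#{p ∣ 2t/f : p ∤ f/2}}` (`f` even)
# (Gritsenko–Hulek–Sankaran, *Compositio Math.* 146 (2010), §4 Prop. 4.12 (ii): the order of the factor group, here
# without the hypothesis `w = 1`)

Trunk T-4MAN vocabulary; sequel of `LatticeFormsPolarisationStabiliserQuotient.lean` (row g44-#13: for EVERY primitive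
`h ∈ L = B₀ ⊕ ⟨−2t⟩` with `div(h) = f`, `|O(L, h)/Õ(L, h)| = #S_f`, `S_f = {x mod 2t : x² ≡ 1 (mod 4t), x ≡ 1 (mod f)}`
(`natCard_quot_stabiliser_discriminantGroupCongr_eq`), and `#S_f = 2^{ρ(t/f)}` ∕ `2^{ρ(2t/f)}` under `(f, 2t/f) = 1`, i.e.
`w = 1`; its `TODO(general form): the order for (f, 2t/f) > 1` this file settles) and of
`LatticeFormsRankOneDiscriminantFormIsometries.lean` (g39: the CRT pattern `Nat.recOnPosPrimePosCoprime` +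
`ZMod.chineseRemainder` of `natCard_sq_eq_one_zmod_of_odd`). Written for lane `lit-hodgefound` (Track 2 foundations; prover
seat `lit-hodgefound-p18`, gen 45, row g45-#3). THEOREMS ONLY — no definition, no named fact, no instance, no notation.

## Source, verbatim (V. Gritsenko, K. Hulek, G. K. Sankaran, Compositio Math. 146 (2010) 404–434, arXiv numbering §4,
held text `paper:arxiv-0802.2078` pp. 12–13)

"**Proposition 4.12.** Let `h_d ∈ L_{2t}` be a primitive vector such that `h_d² = 2d` and `div(h_d) = f`. Assume that
`w = 1`, i.e. `f` and `(2t/f, 2d/f)` are coprime. Then […] (ii) The factor group `O(L_{2t}, h_d)/Õ(L_{2t}, h_d)` is an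
abelian `2`-group, which is of order `2^{ρ(t/f)}` if `f` is odd. If `f` is even the order is equal to `2^{ρ(2t/f)+δ}`, where
`δ = 0` if `(2t/f) ≡ 1 mod 2` or `(2t/f) ≡ 4 mod 8`, `δ = −1` if `(2t/f) ≡ 2 mod 4`, `δ = 1` if `(2t/f) ≡ 0 mod 8`.
*Proof.* […] `O(L_{2t}, h_d)/Õ(L_{2t}, h_d) ≅ […] ≅ O(⟨k̄₃⟩)`, where `⟨k̄₃⟩ = {n k̄₃ ∣ n mod 2t/f}` and
`k̄₃² ≡ −f²/2t mod 2`. Therefore `O(⟨k̄₃⟩) ≅ {x mod 2t/f ∣ x² k̄₃² ≡ k̄₃² mod 2} = {x mod 2t/f ∣ x²f ≡ f mod 2·2t/f}`. We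
supposed that `w = 1`. […] It follows that the group `O(⟨k̄₃⟩)` is isomorphic to the group
`{x mod 2t/f ∣ x² ≡ 1 mod 2^{ε(f)} 2t/f}`, where `ε(f) = 1` if `f` is odd (in this case `2t/f` is even) and `ε(f) = 0` is
`f` is even. The last group is well-known (compare with [GH]). □"

## Reading notes

* THE SET COUNTED. Row g44-#13 identifies, for every primitive `h ∈ L = B₀ ⊕ ⟨−2t⟩` with `(h, L) = fℤ` and with no
  hypothesis on `w`, the classes of the stabiliser `{g ∈ O(L) : g h = h}` modulo equal action on `A_L ≅ ℤ/2t` with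
  `S_f = {x mod 2t : x² ≡ 1 (mod 4t), x ≡ 1 (mod f)}` (the printed `O(⟨k̄₃⟩)`, indexed modulo `2t`). This file counts `S_f`
  for EVERY `f ∣ 2t`: writing `x = 1 + 2my` with `2m = f` (`f` even) resp. `2m = 2f` (`f` odd: `x² ≡ 1 (mod 4)` forces `x`
  odd, so `x ≡ 1 (mod 2f)`), and `t = mT`, one has `x² − 1 = 4m · y(1 + my)` and `4t = 4m · T`, so
  `S_f ≅ {y mod T : y(1 + my) ≡ 0 (mod T)}` (§2); modulo a prime power `p^k ∥ T` the coprime factors `y`, `1 + my` give the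
  solutions `y ≡ 0` and, iff `p ∤ m`, `y ≡ −1/m`, so by the Chinese remainder theorem
  `#S_f = 2^{#{p ∣ T : p ∤ m}}` (§1) — "The last group is well-known (compare with [GH])". Hence
  **`#S_f = 2^{#{p ∣ t/f : p ∤ f}}` for `f` odd and `#S_f = 2^{#{p ∣ 2t/f : p ∤ f/2}}` for `f` even.**
* RELATION TO THE PRINTED ORDERS. Under the proposition's hypothesis `w = 1` — for types that occur `w = (f, 2t/f)` (row
  g44-#1 `gcd_eq_one_of_w_eq_one`, row g45-#1 `gcd_gcd_eq_gcd_of_sq_dvd`) — every prime of `2t/f` (hence of `t/f`) is prime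
  to `f`, the exponents are `ρ(t/f)` resp. `ρ(2t/f)`, and these are the printed orders (and the counts of row g44-#13,
  `natCard_sf_eq_two_pow_of_odd` ∕ `_of_even`); for `f` even `2t/f` is then odd, so the printed `δ` is `0`. The `δ = ±1`
  clauses are stated under `w = 1`, where they are vacuous; they are NOT the law for `w > 1` (e.g. `t = 2`, `f = 2`:
  `S_2 = {1, 3 mod 4}` has `2 = 2^{#{p ∣ 2 : p ∤ 1}}` elements, `natCard_sf_two_two`, where "`2^{ρ(2t/f)+δ}`" with
  `2t/f = 2 ≡ 2 mod 4` would read `2^{1−1} = 1`). Recorded as a reading note on scope; nothing is restated as an erratum,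
  since the proposition assumes `w = 1`.
* "abelian `2`-group" and the group structure of the quotient are not stated (as in g44-#13: no group structure on the
  stabiliser quotient is declared; only its `Nat.card`).
* Numerics first (session folder `num/check46.py`): brute force over `t ≤ 60` and all `f ∣ 2t`: `#S_f` against
  `2^{#{p ∣ t/f : p ∤ f}}` ∕ `2^{#{p ∣ 2t/f : p ∤ f/2}}`, 0 mismatches.

## Contents (all proved)

* §1 (private [folklore] plumbing) `natCard_mul_one_add_mul_eq_zero_zmod_prime_pow` (`#{y mod p^k : y(1 + my) ≡ 0} = 1`
  if `p ∣ m`, `2` if `p ∤ m`) and `natCard_mul_one_add_mul_eq_zero_zmod` (`#{y mod T : y(1 + my) ≡ 0} = 2^{#{p ∣ T : p ∤ m}}`,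
  CRT).
* §2 **`natCard_sf_eq_natCard_zmod`** (`x = 1 + 2my`: `#{x mod 2t : x² ≡ 1 (4t), x ≡ 1 (2m)} = #{y mod T : y(1 + my) ≡ 0}` for
  `t = mT`), **`natCard_sf_eq_two_pow_filter_of_even`** (`f = 2n`: `2^{#{p ∣ t/n : p ∤ n}}`),
  **`natCard_sf_eq_two_pow_filter_of_odd`** (`f` odd: `2^{#{p ∣ t/f : p ∤ f}}`), `natCard_sf_two_two` (`t = f = 2`: `2`).
* §3 `L = B₀ ⊕ ⟨−2t⟩` (`B₀` symmetric even unimodular, two orthogonal hyperbolic pairs, `t ≥ 1`), EVERY primitive `h` with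
  `(h, L) = fℤ`: **`natCard_quot_stabiliser_discriminantGroupCongr_eq_two_pow_filter_of_odd`** (`|O(L,h)/Õ(L,h)| =
  2^{#{p ∣ t/f : p ∤ f}}`) and **`…_of_even`** (`f = 2n`: `2^{#{p ∣ t/n : p ∤ n}}`).
* §4 the models `(E₈(−1)^{⊕m} ⊕ U^{⊕(k+2)}) ⊕ ℤ(−2t)` (`…_model_…`).

## References

* [GritsenkoHulekSankaran2010Symplectic] V. Gritsenko, K. Hulek, G. K. Sankaran, Moduli spaces of irreducible symplectic
  manifolds, Compositio Math. 146 (2010) 404–434 (arXiv:0802.2078): §4 Prop. 4.12 (ii) and its proof.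
* [GritsenkoHulek1998] V. Gritsenko, K. Hulek, Minimal Siegel modular threefolds, Math. Proc. Cambridge Philos. Soc. 123
  (1998) 461–485 (GHS's [GH]: "the last group is well-known").
-/

noncomputable section

open Module Function
open LinearMap (BilinForm)
open LinearMap.BilinForm

namespace Literature.Topology.FourManifolds

universe u

/-! ### §1 `#{y mod T : y(1 + my) ≡ 0 (mod T)} = 2^{#{p ∣ T : p ∤ m}}` -/

section Count

/-- **Modulo a prime power `p^k` (`k ≥ 1`), `y(1 + my) ≡ 0` has the solution `y ≡ 0`, and the further solution
`y ≡ −1/m` exactly when `p ∤ m`** (`y` and `1 + my` are coprime, so one of them is `≡ 0 mod p^k`). (Private plumbing for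
§2.) [folklore] -/
private theorem natCard_mul_one_add_mul_eq_zero_zmod_prime_pow {p : ℕ} (hp : p.Prime) {k : ℕ} (hk : k ≠ 0) (m : ℕ) :
    Nat.card {y : ZMod (p ^ k) // y * (1 + m * y) = 0} = if p ∣ m then 1 else 2 := by
  haveI : Fact (1 < p ^ k) := ⟨Nat.one_lt_pow hk hp.one_lt⟩
  haveI : Fact p.Prime := ⟨hp⟩
  have hdvd : p ∣ p ^ k := dvd_pow_self p hk
  set ψ := ZMod.castHom hdvd (ZMod p) with hψ
  have hψval : ∀ y : ZMod (p ^ k), ψ y = (y.val : ZMod p) := fun y ↦ by rw [hψ, ZMod.castHom_apply, ZMod.cast_eq_val]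
  -- `p ∤ y` ⟹ `y` is a unit
  have hunit : ∀ y : ZMod (p ^ k), ¬p ∣ y.val → IsUnit y := fun y hy ↦ by
    rw [← ZMod.natCast_zmod_val y, ZMod.isUnit_iff_coprime]
    exact (Nat.coprime_comm.1 ((Nat.Prime.coprime_iff_not_dvd hp).2 hy)).pow_right k
  -- `p ∣ y` ⟹ `1 + my` is a unit
  have hunit' : ∀ y : ZMod (p ^ k), p ∣ y.val → IsUnit (1 + (m : ZMod (p ^ k)) * y) := fun y hy ↦ by
    apply hunit
    intro h1
    have e1 : ψ (1 + m * y) = 1 := by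
      rw [map_add, map_one, map_mul, map_natCast, hψval y, (ZMod.natCast_eq_zero_iff _ _).2 hy, mul_zero,
        add_zero]
    have e2 : ψ (1 + m * y) = 0 := by rw [hψval, (ZMod.natCast_eq_zero_iff _ _).2 h1]
    exact one_ne_zero (e1.symm.trans e2)
  have key : ∀ y : ZMod (p ^ k), y * (1 + m * y) = 0 ↔ y = 0 ∨ 1 + (m : ZMod (p ^ k)) * y = 0 := fun y ↦ by
    refine ⟨fun h ↦ ?_, fun h ↦ h.elim (fun h0 ↦ by rw [h0, zero_mul]) (fun h1 ↦ by rw [h1, mul_zero])⟩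
    by_cases hy : p ∣ y.val
    · exact Or.inl ((hunit' y hy).mul_left_eq_zero.1 h)
    · exact Or.inr ((hunit y hy).mul_right_eq_zero.1 h)
  split_ifs with hpm
  · -- `p ∣ m`: `1 + my ≡ 1 (mod p)` never vanishes
    have h1 : ∀ y : ZMod (p ^ k), 1 + (m : ZMod (p ^ k)) * y ≠ 0 := fun y h ↦ by
      have e1 : ψ (1 + m * y) = 1 := by
        rw [map_add, map_one, map_mul, map_natCast, (ZMod.natCast_eq_zero_iff _ _).2 hpm, zero_mul, add_zero]
      rw [h, map_zero] at e1
      exact zero_ne_one e1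
    rw [Nat.card_eq_one_iff_exists]
    exact ⟨⟨0, by rw [zero_mul]⟩, fun y ↦ Subtype.ext (((key y.1).1 y.2).resolve_right (h1 y.1))⟩
  · -- `p ∤ m`: the second solution `y₀ = −1/m`
    have hmu : IsUnit (m : ZMod (p ^ k)) := by
      rw [ZMod.isUnit_iff_coprime]
      exact (Nat.coprime_comm.1 ((Nat.Prime.coprime_iff_not_dvd hp).2 hpm)).pow_right k
    set u := hmu.unit with hu
    have hum : (u : ZMod (p ^ k)) = m := hmu.unit_spec
    set y₀ : ZMod (p ^ k) := -↑u⁻¹ with hy₀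
    have hsol : ∀ y : ZMod (p ^ k), 1 + (m : ZMod (p ^ k)) * y = 0 ↔ y = y₀ := fun y ↦ by
      constructor
      · intro h
        have h2 : (m : ZMod (p ^ k)) * y = -1 := eq_neg_of_add_eq_zero_right h
        calc y = ↑u⁻¹ * (↑u * y) := (Units.inv_mul_cancel_left u y).symm
          _ = y₀ := by rw [hum, h2, mul_neg_one]
      · intro h
        rw [h, hy₀, mul_neg, ← hum, Units.mul_inv, add_neg_cancel]
    have hy₀0 : y₀ ≠ 0 := fun h ↦ by
      have h1 := (hsol y₀).2 rfl
      rw [h, mul_zero, add_zero] at h1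
      exact one_ne_zero h1
    rw [Nat.card_eq_two_iff]
    refine ⟨⟨0, by rw [zero_mul]⟩, ⟨y₀, by rw [(hsol y₀).2 rfl, mul_zero]⟩, fun h ↦ hy₀0 (Subtype.ext_iff.1 h).symm, ?_⟩
    ext y
    simp only [Set.mem_insert_iff, Set.mem_singleton_iff, Set.mem_univ, iff_true]
    rcases (key y.1).1 y.2 with h | h
    · exact Or.inl (Subtype.ext h)
    · exact Or.inr (Subtype.ext ((hsol y.1).1 h))

/-- Along a ring isomorphism `ℤ/ab ≅ ℤ/a × ℤ/b` the solutions of `y(1 + my) = 0` correspond to pairs of solutions.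
[folklore] -/
private theorem natCard_mul_one_add_mul_eq_zero_eq_mul_of_ringEquiv {A B C : Type*} [Ring A] [Ring B] [Ring C]
    (e : A ≃+* B × C) (m : ℕ) :
    Nat.card {y : A // y * (1 + m * y) = 0} =
      Nat.card {x : B // x * (1 + m * x) = 0} * Nat.card {z : C // z * (1 + m * z) = 0} := by
  rw [← Nat.card_prod]
  refine Nat.card_congr ((Equiv.subtypeEquiv e.toEquiv fun y ↦ ?_).trans (Equiv.subtypeProdEquivProd))
  change y * (1 + m * y) = 0 ↔ (e y).1 * (1 + m * (e y).1) = 0 ∧ (e y).2 * (1 + m * (e y).2) = 0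
  rw [← e.injective.eq_iff, map_mul, map_add, map_one, map_mul, map_natCast, map_zero, Prod.ext_iff]
  simp only [Prod.fst_mul, Prod.snd_mul, Prod.fst_add, Prod.snd_add, Prod.fst_one, Prod.snd_one, Prod.fst_natCast,
    Prod.snd_natCast, Prod.fst_zero, Prod.snd_zero]

/-- **`#{y mod T : y(1 + my) ≡ 0 (mod T)} = 2^{#{p ∣ T : p ∤ m}}`** (`T ≥ 1`): Chinese remainder theorem and the prime-power
case ("The last group is well-known"). (Private plumbing for §2.) [folklore] -/
private theorem natCard_mul_one_add_mul_eq_zero_zmod {T : ℕ} (hT : 0 < T) (m : ℕ) :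
    Nat.card {y : ZMod T // y * (1 + m * y) = 0} = 2 ^ (T.primeFactors.filter fun p ↦ ¬p ∣ m).card := by
  induction T using Nat.recOnPosPrimePosCoprime with
  | prime_pow p k hp hk =>
    rw [natCard_mul_one_add_mul_eq_zero_zmod_prime_pow hp hk.ne' m, Nat.primeFactors_prime_pow hk.ne' hp,
      Finset.filter_singleton]
    by_cases hpm : p ∣ m
    · rw [if_pos hpm, if_neg (not_not.2 hpm), Finset.card_empty, pow_zero]
    · rw [if_neg hpm, if_pos hpm, Finset.card_singleton, pow_one]
  | zero => exact absurd hT (lt_irrefl 0)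
  | one =>
    haveI : Subsingleton (ZMod 1) := ZMod.subsingleton_iff.2 rfl
    rw [Nat.primeFactors_one, Finset.filter_empty, Finset.card_empty, pow_zero, Nat.card_eq_one_iff_exists]
    exact ⟨⟨0, by rw [zero_mul]⟩, fun y ↦ Subtype.ext (Subsingleton.elim _ _)⟩
  | coprime a b ha hb hab iha ihb =>
    rw [natCard_mul_one_add_mul_eq_zero_eq_mul_of_ringEquiv (ZMod.chineseRemainder hab) m, iha (by omega),
      ihb (by omega), Nat.primeFactors_mul (by omega) (by omega), Finset.filter_union,
      Finset.card_union_of_disjoint (Finset.disjoint_filter_filter (Nat.Coprime.disjoint_primeFactors hab)), pow_add]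

end Count

/-! ### §2 `S_f = {x mod 2t : x² ≡ 1 (mod 4t), x ≡ 1 (mod f)}` re-indexed by `x = 1 + 2my`: `#S_f` in closed form -/

section Reindex

/-- The canonical lift of `a mod n` is congruent to `a`. [folklore] -/
private theorem natCast_dvd_val_intCast_sub' (n : ℕ) [NeZero n] (a : ℤ) : (n : ℤ) ∣ (((a : ZMod n)).val : ℤ) - a :=
  (ZMod.intCast_eq_intCast_iff_dvd_sub a _ n).1 (by rw [Int.cast_natCast, ZMod.natCast_zmod_val])

/-- `(Y mod T)·(1 + m(Y mod T)) = 0` in `ℤ/T` iff `T ∣ Y(1 + mY)`. [folklore] -/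
private theorem intCast_mul_one_add_mul_eq_zero_iff (T m : ℕ) (Y : ℤ) :
    (Y : ZMod T) * (1 + (m : ZMod T) * (Y : ZMod T)) = 0 ↔ (T : ℤ) ∣ Y * (1 + m * Y) := by
  rw [← ZMod.intCast_zmod_eq_zero_iff_dvd, Int.cast_mul, Int.cast_add, Int.cast_one, Int.cast_mul, Int.cast_natCast]

/-- `(a : ℤ/n) = σ ⟺ n ∣ σ.val − a`. [folklore] -/
private theorem intCast_eq_iff_dvd_val_sub (n : ℕ) [NeZero n] (a : ℤ) (σ : ZMod n) :
    (a : ZMod n) = σ ↔ (n : ℤ) ∣ (σ.val : ℤ) - a := by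
  conv_lhs => rw [← ZMod.natCast_zmod_val σ, ← Int.cast_natCast]
  exact ZMod.intCast_eq_intCast_iff_dvd_sub _ _ _

/-- **`x = 1 + 2my` re-indexes `{x mod 2t : x² ≡ 1 (mod 4t), x ≡ 1 (mod 2m)}` by `{y mod T : y(1 + my) ≡ 0 (mod T)}`** when
`t = mT`: `x² − 1 = 4m · y(1 + my)` and `4t = 4m · T` ("`O(⟨k̄₃⟩) ≅ {x mod 2t/f ∣ x²f ≡ f mod 2·2t/f}`", re-indexed).
[cite: GritsenkoHulekSankaran2010Symplectic, §4 proof of Prop. 4.12 (ii)] -/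
theorem natCard_sf_eq_natCard_zmod {t m T : ℕ} (hm : 0 < m) (hT : 0 < T) (htm : t = m * T) :
    Nat.card {σ : ZMod (2 * t) // (4 * t : ℤ) ∣ (σ.val : ℤ) ^ 2 - 1 ∧ (2 * m : ℤ) ∣ (σ.val : ℤ) - 1} =
      Nat.card {y : ZMod T // y * (1 + m * y) = 0} := by
  have ht : 0 < t := by rw [htm]; positivity
  haveI : NeZero (2 * t) := ⟨by omega⟩
  haveI : NeZero T := ⟨hT.ne'⟩
  have hm0 : (2 * m : ℤ) ≠ 0 := by positivity
  have hm4 : (4 * m : ℤ) ≠ 0 := by positivity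
  have h2t : ((2 * t : ℕ) : ℤ) = 2 * m * T := by rw [htm]; push_cast; ring
  have h4t : (4 * t : ℤ) = 4 * m * T := by rw [htm]; push_cast; ring
  refine Nat.card_congr
    { toFun := fun σ ↦ ⟨((((σ.1.val : ℤ) - 1) / (2 * m) : ℤ) : ZMod T), ?_⟩
      invFun := fun y ↦ ⟨((1 + 2 * m * (y.1.val : ℤ) : ℤ) : ZMod (2 * t)), ?_, ?_⟩
      left_inv := fun σ ↦ ?_
      right_inv := fun y ↦ ?_ }
  · -- `x² − 1 = 4m·Y(1 + mY)` with `x − 1 = 2mY`, so `T ∣ Y(1 + mY)`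
    have hY : 2 * m * (((σ.1.val : ℤ) - 1) / (2 * m)) = (σ.1.val : ℤ) - 1 := Int.mul_ediv_cancel' σ.2.2
    rw [intCast_mul_one_add_mul_eq_zero_iff]
    have h1 : (4 * m : ℤ) * T ∣ 4 * m * ((((σ.1.val : ℤ) - 1) / (2 * m)) * (1 + m * (((σ.1.val : ℤ) - 1) / (2 * m)))) := by
      have e : 4 * m * ((((σ.1.val : ℤ) - 1) / (2 * m)) * (1 + m * (((σ.1.val : ℤ) - 1) / (2 * m)))) =
          (σ.1.val : ℤ) ^ 2 - 1 := by
        linear_combination ((σ.1.val : ℤ) + 1 + 2 * m * (((σ.1.val : ℤ) - 1) / (2 * m))) * hY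
      rw [e, ← h4t]
      exact σ.2.1
    exact (mul_dvd_mul_iff_left hm4).1 h1
  · -- `4t ∣ σ'.val² − 1`: `σ'.val ≡ a = 1 + 2m·y.val (mod 2t)` and `a² − 1 = 4m · y.val(1 + m y.val)`, `T ∣ y.val(1 + m y.val)`
    have hv0 := natCast_dvd_val_intCast_sub' (2 * t) (1 + 2 * m * (y.1.val : ℤ))
    have hvt : 2 * (t : ℤ) ∣ ((((1 + 2 * m * (y.1.val : ℤ) : ℤ) : ZMod (2 * t))).val : ℤ) -
        (1 + 2 * m * (y.1.val : ℤ)) := by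
      have e2 : (2 * (t : ℤ)) = ((2 * t : ℕ) : ℤ) := by push_cast; ring
      rw [e2]
      exact hv0
    have h1 : (4 * t : ℤ) ∣ ((((1 + 2 * m * (y.1.val : ℤ) : ℤ) : ZMod (2 * t))).val : ℤ) ^ 2 -
        (1 + 2 * m * (y.1.val : ℤ)) ^ 2 :=
      four_mul_dvd_sq_sub_sq_of_dvd_sub hvt
    have h2 : (T : ℤ) ∣ (y.1.val : ℤ) * (1 + m * (y.1.val : ℤ)) := by
      rw [← intCast_mul_one_add_mul_eq_zero_iff, Int.cast_natCast, ZMod.natCast_zmod_val]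
      exact y.2
    have h3 : (4 * t : ℤ) ∣ (1 + 2 * m * (y.1.val : ℤ)) ^ 2 - 1 := by
      rw [h4t, show (1 + 2 * m * (y.1.val : ℤ)) ^ 2 - 1 = 4 * m * ((y.1.val : ℤ) * (1 + m * (y.1.val : ℤ))) by ring]
      exact mul_dvd_mul_left _ h2
    have h4 := dvd_add h1 h3
    rwa [sub_add_sub_cancel] at h4
  · -- `2m ∣ σ'.val − 1`
    have hv := natCast_dvd_val_intCast_sub' (2 * t) (1 + 2 * m * (y.1.val : ℤ))
    rw [h2t] at hv
    have e : ((((1 + 2 * m * (y.1.val : ℤ) : ℤ) : ZMod (2 * t))).val : ℤ) - 1 =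
        (((((1 + 2 * m * (y.1.val : ℤ) : ℤ) : ZMod (2 * t))).val : ℤ) - (1 + 2 * m * (y.1.val : ℤ))) +
          2 * m * (y.1.val : ℤ) := by ring
    rw [e]
    exact dvd_add ((dvd_mul_right (2 * (m : ℤ)) T).trans hv) (dvd_mul_right _ _)
  · -- `left_inv`: `1 + 2m·((x − 1)/2m mod T) ≡ x (mod 2t)`
    apply Subtype.ext
    have hY : 2 * m * (((σ.1.val : ℤ) - 1) / (2 * m)) = (σ.1.val : ℤ) - 1 := Int.mul_ediv_cancel' σ.2.2
    have hv := natCast_dvd_val_intCast_sub' T (((σ.1.val : ℤ) - 1) / (2 * m))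
    change ((1 + 2 * m * ((((((σ.1.val : ℤ) - 1) / (2 * m) : ℤ) : ZMod T)).val : ℤ) : ℤ) : ZMod (2 * t)) = σ.1
    rw [intCast_eq_iff_dvd_val_sub, h2t]
    have e : (σ.1.val : ℤ) - (1 + 2 * m * ((((((σ.1.val : ℤ) - 1) / (2 * m) : ℤ) : ZMod T)).val : ℤ)) =
        -(2 * m * (((((((σ.1.val : ℤ) - 1) / (2 * m) : ℤ) : ZMod T)).val : ℤ) - ((σ.1.val : ℤ) - 1) / (2 * m))) := by
      linear_combination -hY
    rw [e, dvd_neg]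
    exact mul_dvd_mul_left _ hv
  · -- `right_inv`: `((1 + 2m·y.val mod 2t) − 1)/2m ≡ y.val (mod T)`
    apply Subtype.ext
    obtain ⟨q, hq⟩ := natCast_dvd_val_intCast_sub' (2 * t) (1 + 2 * m * (y.1.val : ℤ))
    rw [h2t] at hq
    have e : ((((1 + 2 * m * (y.1.val : ℤ) : ℤ) : ZMod (2 * t))).val : ℤ) - 1 = 2 * m * ((y.1.val : ℤ) + T * q) := by
      linear_combination hq
    change (((((((1 + 2 * m * (y.1.val : ℤ) : ℤ) : ZMod (2 * t))).val : ℤ) - 1) / (2 * m) : ℤ) : ZMod T) = y.1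
    rw [e, Int.mul_ediv_cancel_left _ hm0]
    push_cast
    rw [ZMod.natCast_zmod_val, ZMod.natCast_self, zero_mul, add_zero]

/-- **`f = 2n` even: `#{x mod 2t : x² ≡ 1 (mod 4t), x ≡ 1 (mod 2n)} = 2^{#{p ∣ t/n : p ∤ n}}`** (`2n ∣ 2t`, `t ≥ 1`; `t/n = 2t/f`)
— for `(f, 2t/f) = 1` every prime of `2t/f` is prime to `n` and this is the `2^{ρ(2t/f)}` of Prop. 4.12 (ii)
(`natCard_sf_eq_two_pow_of_even`). [cite: GritsenkoHulekSankaran2010Symplectic, §4 Prop. 4.12 (ii) and proof ("The last group is well-known")] -/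
theorem natCard_sf_eq_two_pow_filter_of_even {t n : ℕ} (ht : 0 < t) (hn : 0 < n) (hft : (2 * n : ℤ) ∣ 2 * t) :
    Nat.card {σ : ZMod (2 * t) // (4 * t : ℤ) ∣ (σ.val : ℤ) ^ 2 - 1 ∧ (2 * n : ℤ) ∣ (σ.val : ℤ) - 1} =
      2 ^ ((t / n).primeFactors.filter fun p ↦ ¬p ∣ n).card := by
  obtain ⟨T, hT⟩ : n ∣ t := by
    have h1 : (n : ℤ) ∣ t := Int.dvd_of_mul_dvd_mul_left (by norm_num) hft
    exact_mod_cast h1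
  have hT0 : 0 < T := Nat.pos_of_ne_zero fun h ↦ by rw [h, mul_zero] at hT; omega
  rw [natCard_sf_eq_natCard_zmod hn hT0 hT, natCard_mul_one_add_mul_eq_zero_zmod hT0 n, hT,
    Nat.mul_div_cancel_left T hn]

/-- **`f` odd: `#{x mod 2t : x² ≡ 1 (mod 4t), x ≡ 1 (mod f)} = 2^{#{p ∣ t/f : p ∤ f}}`** (`f ∣ 2t`, so `f ∣ t`; `t ≥ 1`): an
`x` with `x² ≡ 1 (mod 4)` is odd, so `x ≡ 1 (mod 2f)` and `x = 1 + 2fy` — for `(f, 2t/f) = 1` every prime of `t/f` is prime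
to `f` and this is the `2^{ρ(t/f)}` of Prop. 4.12 (ii) (`natCard_sf_eq_two_pow_of_odd`).
[cite: GritsenkoHulekSankaran2010Symplectic, §4 Prop. 4.12 (ii) and proof ("`ε(f) = 1` if `f` is odd")] -/
theorem natCard_sf_eq_two_pow_filter_of_odd {t f : ℕ} (ht : 0 < t) (hfo : Odd f) (hft : (f : ℤ) ∣ 2 * t) :
    Nat.card {σ : ZMod (2 * t) // (4 * t : ℤ) ∣ (σ.val : ℤ) ^ 2 - 1 ∧ (f : ℤ) ∣ (σ.val : ℤ) - 1} =
      2 ^ ((t / f).primeFactors.filter fun p ↦ ¬p ∣ f).card := by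
  obtain ⟨k, hk⟩ := hfo
  have hf0 : 0 < f := by omega
  have hf2 : IsCoprime (2 : ℤ) (f : ℤ) := ⟨-(k : ℤ), 1, by rw [hk]; push_cast; ring⟩
  obtain ⟨T, hT⟩ : f ∣ t := by
    have h1 : (f : ℤ) ∣ t := hf2.symm.dvd_of_dvd_mul_left hft
    exact_mod_cast h1
  have hT0 : 0 < T := Nat.pos_of_ne_zero fun h ↦ by rw [h, mul_zero] at hT; omega
  -- `x² ≡ 1 (mod 4)` forces `x` odd, so `f ∣ x − 1 ⟺ 2f ∣ x − 1`
  have key : ∀ σ : ZMod (2 * t), (4 * t : ℤ) ∣ (σ.val : ℤ) ^ 2 - 1 ∧ (f : ℤ) ∣ (σ.val : ℤ) - 1 ↔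
      (4 * t : ℤ) ∣ (σ.val : ℤ) ^ 2 - 1 ∧ (2 * f : ℤ) ∣ (σ.val : ℤ) - 1 := fun σ ↦ by
    refine ⟨fun h ↦ ⟨h.1, hf2.mul_dvd ?_ h.2⟩, fun h ↦ ⟨h.1, (dvd_mul_left (f : ℤ) 2).trans h.2⟩⟩
    have h2 : (2 : ℤ) ∣ (σ.val : ℤ) ^ 2 - 1 := (show (2 : ℤ) ∣ 4 * t from ⟨2 * t, by ring⟩).trans h.1
    rcases Int.even_or_odd (σ.val : ℤ) with he | ho
    · exfalso
      have hx2 : (2 : ℤ) ∣ (σ.val : ℤ) ^ 2 := dvd_pow (even_iff_two_dvd.1 he) two_ne_zero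
      have h1 : (2 : ℤ) ∣ 1 := by
        have h3 := dvd_sub hx2 h2
        rwa [sub_sub_cancel] at h3
      norm_num at h1
    · exact even_iff_two_dvd.1 (ho.sub_odd odd_one)
  rw [Nat.card_congr (Equiv.subtypeEquivRight key), natCard_sf_eq_natCard_zmod hf0 hT0 hT,
    natCard_mul_one_add_mul_eq_zero_zmod hT0 f, hT, Nat.mul_div_cancel_left T hf0]

/-- **`t = 2`, `f = 2`: `S_2 = {x mod 4 : x² ≡ 1 (mod 8), x ≡ 1 (mod 2)} = {1, 3}` has `2` elements** — here
`(f, 2t/f) = 2`, outside Prop. 4.12's hypothesis `w = 1` (see the reading notes on `δ`); the set is the printed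
`O(⟨k̄₃⟩) ≅ {x mod 2t ∣ …}` of the proof (valid for every `f`, row g44-#13), evaluated at `t = f = 2`.
[cite: GritsenkoHulekSankaran2010Symplectic, §4 proof of Prop. 4.12 (ii) (the set `O(⟨k̄₃⟩)`), at `t = f = 2`] -/
theorem natCard_sf_two_two :
    Nat.card {σ : ZMod (2 * 2) // (4 * ((2 : ℕ) : ℤ)) ∣ (σ.val : ℤ) ^ 2 - 1 ∧ (2 * ((1 : ℕ) : ℤ)) ∣ (σ.val : ℤ) - 1} = 2 := by
  rw [natCard_sf_eq_two_pow_filter_of_even (t := 2) (n := 1) two_pos one_pos ⟨2, by norm_num⟩, Nat.div_one,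
    Nat.Prime.primeFactors Nat.prime_two, Finset.filter_singleton, if_pos (by norm_num), Finset.card_singleton, pow_one]

end Reindex

/-! ### §3 Prop. 4.12 (ii) for every divisor: `|O(L, h)/Õ(L, h)|` in closed form, `L = B₀ ⊕ ⟨−2t⟩` -/

section Lattice

variable {M : Type u} [AddCommGroup M] [Module.Finite ℤ M] [Module.Free ℤ M] {B₀ : BilinForm ℤ M} (t : ℕ)

/-- `f ∣ 2t` for the divisor data of a primitive vector of `B₀ ⊕ ⟨−2t⟩`. [folklore] -/
private theorem dvd_two_mul_of_primitive (hu : B₀.IsUnimodular) {r : M × ℤ} {f : ℤ} (hr0 : r ≠ 0)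
    (hsat : ∀ (k : ℤ) (w : M × ℤ), k ≠ 0 → k • w ∈ ℤ ∙ r → w ∈ ℤ ∙ r)
    (hfr : ∀ z, f ∣ B₀.prod ((-(2 * t : ℤ)) • LinearMap.mul ℤ ℤ) r z) : f ∣ 2 * t := by
  haveI : Module.IsTorsionFree ℤ M := inferInstance
  exact Int.dvd_of_dvd_mul_left_of_gcd_one (dvd_two_mul_mul_snd_of_forall_dvd t hfr)
    (gcd_snd_eq_one_of_primitive_of_forall_dvd t hu hr0 hsat hfr)

/-- **Prop. 4.12 (ii) for EVERY odd divisor `f` (no `w` hypothesis): the stabiliser `{g ∈ O(L) : g h = h}` of a primitive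
`h ∈ L = B₀ ⊕ ⟨−2t⟩` with `(h, L) = fℤ` has exactly `2^{#{p ∣ t/f : p ∤ f}}` distinct actions on `A_L`** ("which is of order
`2^{ρ(t/f)}` if `f` is odd" under `w = 1`, where every prime of `t/f` is prime to `f`). `B₀` symmetric even unimodular with two
orthogonal hyperbolic pairs, `t ≥ 1`. [cite: GritsenkoHulekSankaran2010Symplectic, §4 Prop. 4.12 (ii)] -/
theorem natCard_quot_stabiliser_discriminantGroupCongr_eq_two_pow_filter_of_odd (hu : B₀.IsUnimodular)
    (hs₀ : B₀.IsSymm) (he : B₀.IsEven) (ht : 0 < t) {x y x₁ y₁ : M} (hP : TwoHyperbolicPairs B₀ x y x₁ y₁)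
    {r r' : M × ℤ} {f : ℕ} (hfo : Odd f) (hr0 : r ≠ 0)
    (hsat : ∀ (k : ℤ) (w : M × ℤ), k ≠ 0 → k • w ∈ ℤ ∙ r → w ∈ ℤ ∙ r)
    (hfr : ∀ z, (f : ℤ) ∣ B₀.prod ((-(2 * t : ℤ)) • LinearMap.mul ℤ ℤ) r z)
    (hr' : B₀.prod ((-(2 * t : ℤ)) • LinearMap.mul ℤ ℤ) r r' = f) :
    Nat.card (Quot fun g g' : {g : (B₀.prod ((-(2 * t : ℤ)) • LinearMap.mul ℤ ℤ)).IsometryEquiv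
        (B₀.prod ((-(2 * t : ℤ)) • LinearMap.mul ℤ ℤ)) // g r = r} ↦
        g.1.discriminantGroupCongr = g'.1.discriminantGroupCongr) =
      2 ^ ((t / f).primeFactors.filter fun p ↦ ¬p ∣ f).card := by
  have hf0 : (f : ℤ) ≠ 0 := by exact_mod_cast hfo.pos.ne'
  rw [natCard_quot_stabiliser_discriminantGroupCongr_eq t hu hs₀ he ht hP hf0 hr0 hsat hfr hr']
  exact natCard_sf_eq_two_pow_filter_of_odd ht hfo (dvd_two_mul_of_primitive t hu hr0 hsat hfr)

/-- **Prop. 4.12 (ii) for EVERY even divisor `f = 2n` (no `w` hypothesis): the stabiliser of a primitive `h ∈ L = B₀ ⊕ ⟨−2t⟩`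
with `(h, L) = 2nℤ` has exactly `2^{#{p ∣ 2t/f : p ∤ n}}` distinct actions on `A_L`** (`2t/f = t/n`; "If `f` is even the order
is equal to `2^{ρ(2t/f)+δ}`" under `w = 1`, where `2t/f` is odd, prime to `n`, and `δ = 0`). `B₀` symmetric even unimodular
with two orthogonal hyperbolic pairs, `t ≥ 1`. [cite: GritsenkoHulekSankaran2010Symplectic, §4 Prop. 4.12 (ii)] -/
theorem natCard_quot_stabiliser_discriminantGroupCongr_eq_two_pow_filter_of_even (hu : B₀.IsUnimodular)
    (hs₀ : B₀.IsSymm) (he : B₀.IsEven) (ht : 0 < t) {x y x₁ y₁ : M} (hP : TwoHyperbolicPairs B₀ x y x₁ y₁)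
    {r r' : M × ℤ} {n : ℕ} (hn : 0 < n) (hr0 : r ≠ 0)
    (hsat : ∀ (k : ℤ) (w : M × ℤ), k ≠ 0 → k • w ∈ ℤ ∙ r → w ∈ ℤ ∙ r)
    (hfr : ∀ z, (2 * n : ℤ) ∣ B₀.prod ((-(2 * t : ℤ)) • LinearMap.mul ℤ ℤ) r z)
    (hr' : B₀.prod ((-(2 * t : ℤ)) • LinearMap.mul ℤ ℤ) r r' = 2 * n) :
    Nat.card (Quot fun g g' : {g : (B₀.prod ((-(2 * t : ℤ)) • LinearMap.mul ℤ ℤ)).IsometryEquiv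
        (B₀.prod ((-(2 * t : ℤ)) • LinearMap.mul ℤ ℤ)) // g r = r} ↦
        g.1.discriminantGroupCongr = g'.1.discriminantGroupCongr) =
      2 ^ ((t / n).primeFactors.filter fun p ↦ ¬p ∣ n).card := by
  have hf0 : (2 * n : ℤ) ≠ 0 := by positivity
  rw [natCard_quot_stabiliser_discriminantGroupCongr_eq t hu hs₀ he ht hP hf0 hr0 hsat hfr hr']
  exact natCard_sf_eq_two_pow_filter_of_even ht hn (dvd_two_mul_of_primitive t hu hr0 hsat hfr)

end Lattice

/-! ### §4 The models `(E₈(−1)^{⊕m} ⊕ U^{⊕(k+2)}) ⊕ ℤ(−2t)` (`L_{2t}`: `m = 2`, `k = 1`) -/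

section Model

variable (m k t : ℕ)

/-- **Prop. 4.12 (ii) for every odd divisor `f`, in the models**: `2^{#{p ∣ t/f : p ∤ f}}` distinct actions of the stabiliser on
`A_L`. [cite: GritsenkoHulekSankaran2010Symplectic, §4 Prop. 4.12 (ii)] -/
theorem natCard_quot_stabiliser_discriminantGroupCongr_model_eq_two_pow_filter_of_odd (ht : 0 < t)
    {r r' : ((Fin m → Fin 8 → ℤ) × ((Fin (k + 2) → ℤ) × (Fin (k + 2) → ℤ))) × ℤ} {f : ℕ} (hfo : Odd f) (hr0 : r ≠ 0)
    (hsat : ∀ (a : ℤ) (w : ((Fin m → Fin 8 → ℤ) × ((Fin (k + 2) → ℤ) × (Fin (k + 2) → ℤ))) × ℤ), a ≠ 0 →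
      a • w ∈ ℤ ∙ r → w ∈ ℤ ∙ r)
    (hfr : ∀ z, (f : ℤ) ∣ (((LinearMap.BilinForm.pi fun _ : Fin m ↦ -e8Form).prod (hyperbolicSum (k + 2))).prod
        ((-(2 * t : ℤ)) • LinearMap.mul ℤ ℤ)) r z)
    (hr' : (((LinearMap.BilinForm.pi fun _ : Fin m ↦ -e8Form).prod (hyperbolicSum (k + 2))).prod
        ((-(2 * t : ℤ)) • LinearMap.mul ℤ ℤ)) r r' = f) :
    Nat.card (Quot fun g g' : {g : ((((LinearMap.BilinForm.pi fun _ : Fin m ↦ -e8Form).prod (hyperbolicSum (k + 2))).prod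
        ((-(2 * t : ℤ)) • LinearMap.mul ℤ ℤ))).IsometryEquiv
        ((((LinearMap.BilinForm.pi fun _ : Fin m ↦ -e8Form).prod (hyperbolicSum (k + 2))).prod
        ((-(2 * t : ℤ)) • LinearMap.mul ℤ ℤ))) // g r = r} ↦ g.1.discriminantGroupCongr = g'.1.discriminantGroupCongr) =
      2 ^ ((t / f).primeFactors.filter fun p ↦ ¬p ∣ f).card := by
  obtain ⟨hsB, heB, huB⟩ := isSymm_isEven_isUnimodular_pi_neg_e8Form_prod_hyperbolicSum' m (k + 2)
  exact natCard_quot_stabiliser_discriminantGroupCongr_eq_two_pow_filter_of_odd t huB hsB heB ht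
    (twoHyperbolicPairs_pi_neg_e8Form_prod_hyperbolicSum_add_two m k) hfo hr0 hsat hfr hr'

/-- **Prop. 4.12 (ii) for every even divisor `f = 2n`, in the models**: `2^{#{p ∣ t/n : p ∤ n}}` distinct actions of the
stabiliser on `A_L`. [cite: GritsenkoHulekSankaran2010Symplectic, §4 Prop. 4.12 (ii)] -/
theorem natCard_quot_stabiliser_discriminantGroupCongr_model_eq_two_pow_filter_of_even (ht : 0 < t)
    {r r' : ((Fin m → Fin 8 → ℤ) × ((Fin (k + 2) → ℤ) × (Fin (k + 2) → ℤ))) × ℤ} {n : ℕ} (hn : 0 < n) (hr0 : r ≠ 0)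
    (hsat : ∀ (a : ℤ) (w : ((Fin m → Fin 8 → ℤ) × ((Fin (k + 2) → ℤ) × (Fin (k + 2) → ℤ))) × ℤ), a ≠ 0 →
      a • w ∈ ℤ ∙ r → w ∈ ℤ ∙ r)
    (hfr : ∀ z, (2 * n : ℤ) ∣ (((LinearMap.BilinForm.pi fun _ : Fin m ↦ -e8Form).prod (hyperbolicSum (k + 2))).prod
        ((-(2 * t : ℤ)) • LinearMap.mul ℤ ℤ)) r z)
    (hr' : (((LinearMap.BilinForm.pi fun _ : Fin m ↦ -e8Form).prod (hyperbolicSum (k + 2))).prod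
        ((-(2 * t : ℤ)) • LinearMap.mul ℤ ℤ)) r r' = 2 * n) :
    Nat.card (Quot fun g g' : {g : ((((LinearMap.BilinForm.pi fun _ : Fin m ↦ -e8Form).prod (hyperbolicSum (k + 2))).prod
        ((-(2 * t : ℤ)) • LinearMap.mul ℤ ℤ))).IsometryEquiv
        ((((LinearMap.BilinForm.pi fun _ : Fin m ↦ -e8Form).prod (hyperbolicSum (k + 2))).prod
        ((-(2 * t : ℤ)) • LinearMap.mul ℤ ℤ))) // g r = r} ↦ g.1.discriminantGroupCongr = g'.1.discriminantGroupCongr) =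
      2 ^ ((t / n).primeFactors.filter fun p ↦ ¬p ∣ n).card := by
  obtain ⟨hsB, heB, huB⟩ := isSymm_isEven_isUnimodular_pi_neg_e8Form_prod_hyperbolicSum' m (k + 2)
  exact natCard_quot_stabiliser_discriminantGroupCongr_eq_two_pow_filter_of_even t huB hsB heB ht
    (twoHyperbolicPairs_pi_neg_e8Form_prod_hyperbolicSum_add_two m k) hn hr0 hsat hfr hr'

end Model

end Literature.Topology.FourManifolds
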